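import Summits.QuantumFields.BalabanUV.Beta.GAN24.CombChargeConservationRowLegSym

/-!
# `BalabanUV.Beta.GAN24.CombChargeConservationRowLegSymContact` — binder row G-an2-4 ∕ (CONV-C), TRANSFER-III (the (α-0) chain at row D1's literal of record (III′)):
# **THE (III′) END FROM road-P2 g56's SIX S-SLOT CONTACT LETTERS AND (d″) ONE-STEP CONSERVATION OF THE LEG-AND-BOND-SYMMETRISED ff ZERO-MODE CHARGE — NOTHING ELSE**
# (§4 of the OWNER g51's `CombChargeConservationRowLegSym`, its own module for the 400-line bound; = the OWNER g50's `CombChargeConservationRowContact` with (d′) weakened to (d″))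

NOT IN PRINT; OUR BOOKKEEPING ([folklore] composition BY NAME at weight 0; 0 `def`, 0 cited facts, 0 `def … : Prop`, 0 sorry; OWNER `b2b-balaban-gan24-p1`, gen 51; no existing file touched).
HONEST FRAMING (cell contract, verbatim): «discharging `BetaPertH` makes Bałaban's UV stability UNCONDITIONAL — a real constructive-QFT result; it is NOT the continuum limit and NOT
the Clay problem.»  HONEST DEPENDENCY (verbatim): «continuum YM on T⁴ ⇐ BetaPertH ∧ nine spine estimates (0/9 proved); BetaPertH ⇐ (D1) ∧ (D4) ∧ CAP+tail; G-an2-4 gates asym, D1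
and NE2/3/4.»
WHAT.  **`exists_allScalesSeq_JsB12CombShSym_an1_of_contactLetters_legBondSymConserved`** (`d = 3`, `Lc` odd, `2 ≤ Lc`, `2 ≤ N`, an1's record `symTablesAn1S2 3 Lc cΛ`, locks `cΛ·Lc⁴ = 2`,
`cB = −Lc¹²∕4`): `∃ κ θ<1, AllScalesSeq (j ↦ secondMoment (TbalOf Lc (JsB12CombShSym hLc N (symTablesAn1S2 3 Lc cΛ) cΛ cB) j) μ ν) κ θ` ⟸ road-P2 g56's six S-slot CONTACT LETTERS
`hCT hCTd hCg hPc hCv hPcV` (leaf-01 g83's `CombTowerEndAtPin.exists_allScalesSeq_JsB12CombShSym_an1_of_contactLetters_at_pin`) ∧ (d″) `∀ l κ κ′ κ₁ κ₂, LS_Lc (T̃′♮_{l+1}) = LS_Lc (T̃′♮_l)`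
(`hC` supplied by `CombChargeConservationRowLegSym.legBondSymSource_comb_eq_zero_iff` ⨾ `zsym_relSource_comb_even_of_legBondSym` ⨾ `one_smul`) — BOTH slots in campaign currency, NOTHING ELSE.
WHAT THIS IS NOT.  Both rows DISPLAYED; (d″) NOT proved (engine item E0, band «LS»); asserts NO value of Bałaban's tables and NO value of any charge; NOT one S-∕W-slot row discharged as a
VALUE; the (III′) campaign is NOT asked (an2 W-4) — zero weight; NEVER «G-an2-4 closed» as (CONV-C); NOT D1, NOT `BetaPertH`, NOT continuum, NOT Clay; not in print.  2026-08-27.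
-/

noncomputable section

open Finset
open scoped BigOperators
open Literature.MathematicalPhysics.QuantumFieldTheory
open Literature.MathematicalPhysics.QuantumFieldTheory.Balaban1983to89
open Literature.MathematicalPhysics.QuantumFieldTheory.Balaban1983to89.Beta
open RemainderConstAllScales (AllScalesSeq)
open ExpKernelCalculus (MKer Decays shiftK)
open OneStepResolventKernel (Fib LocStencil decays_mono)
open OneStepKernelFamily (KInvStep decays_KInvStep TbalOf D1Drift)
open AffineAveraging (box toSite)
open BalabanCompositeJets (LocStencil₂ LocStencil₂.mono)
open SecondOrderResponse (W2SymOfK)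
open BalabanStepJetsSucc (mmRead)
open BalabanStepW2 (K3OfK M2Of)
open WilsonVertex2Sym (wsym22)
open Summit.QuantumFields.BalabanUV.Beta.TameKernelCalculus (trK)
open Summit.QuantumFields.BalabanUV.Beta.BorderedHessian (sgnK)
open Summit.QuantumFields.BalabanUV.Beta.HessKerDressedUnits (unitK unitS decays_unitK)
open Summit.QuantumFields.BalabanUV.Beta.SecondOrderUnits (unitM unitS₂ unitM₂)
open Summit.QuantumFields.BalabanUV.Beta.SpineRooted (T2RecOf T2RecAt T2RecOf_zero_level T2RecAt_zero_level)
open WilsonBiStencil (wilsonW₂)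
open Summit.QuantumFields.BalabanUV.Beta.SymmetrisedStepJets (SymTables)
open Summit.QuantumFields.BalabanUV.Beta.CombChartStepJets (GcombSh ScombOf SpureCombOf)
open Summit.QuantumFields.BalabanUV.Beta.CombChartJointEnd (JsB12CombShSym)
open Summit.QuantumFields.BalabanUV.Beta.SymSecondOrderTablesAn1 (symTablesAn1S2)
open Summit.QuantumFields.BalabanUV.Beta.GAN24.CombesThomas (sfStep smStep)
open Summit.QuantumFields.BalabanUV.Beta.GAN24.T2RecursionAffine (lin4)
open Summit.QuantumFields.BalabanUV.Beta.GAN24.BiStencilZeroMode (Tab zmode)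
open Summit.QuantumFields.BalabanUV.Beta.GAN24.WSlotFirstDiff (zmode_sub)
open Summit.QuantumFields.BalabanUV.Beta.GAN24.Lin4ZeroMode (locStencil₂_lin4 zmode_lin4_step)
open Summit.QuantumFields.BalabanUV.Beta.GAN24.T2RecChargeLedger (charge_factor_eq_one_of_pinEq)
open Summit.QuantumFields.BalabanUV.Beta.GAN24.T2RecChargeStep (zmode_member_zero)
open Summit.QuantumFields.BalabanUV.Beta.GAN24.CombRelSourceHalfCharge (locStencil₂_unitS₂_T2RecOf_comb zsym_relSource_comb_half)
open Summit.QuantumFields.BalabanUV.Beta.GAN24.CombT2DriftEvenEnd (unitS₂_T2RecOf_comb_translate)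
open Summit.QuantumFields.BalabanUV.Beta.GAN24.CombTowerEndAtPin (exists_allScalesSeq_JsB12CombShSym_an1_of_sRows_at_pin d1Drift_JsB12CombShSym_an1_iff_lim_eq_of_sRows_at_pin)
open ExpKernelCalculus (MKer comp)
open OneStepResolventKernel (Fib LocStencil)
open OneStepKernelFamily (KInvStep TbalOf D1Drift)
open KernelWard (divV)
open AffineAveraging (box toSite unitVec Site)
open AveragingContoursRooted (ctr ctrOff ctrOff_mem_box)
open BalabanCompositeJets (LocStencil₂ respStep)
open B4ContourShift (supNorm)
open StepJetData (wilsonA)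
open Summit.QuantumFields.BalabanUV.Beta.BorderedHessian (sgnK diagK)
open Summit.QuantumFields.BalabanUV.Beta.AveragingWardRootedStencils (legInd)
open Summit.QuantumFields.BalabanUV.Beta.HessKerDressedUnits (unitK unitS)
open Summit.QuantumFields.BalabanUV.Beta.SpineRooted (T2RecOf)
open Summit.QuantumFields.BalabanUV.Beta.SymCorrectorKernel (psiKS)
open Summit.QuantumFields.BalabanUV.Beta.SymAveragingHessianCounts (symHessFFAt symVhSAt)
open Summit.QuantumFields.BalabanUV.Beta.GAN24.CombesThomas (sfStep smStep KStepUnit SupBound)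
open Summit.QuantumFields.BalabanUV.Beta.GAN24.BiStencilZeroMode (zmode)
open Summit.QuantumFields.BalabanUV.Beta.GAN24.Push4 (legComp IsFF)
open Summit.QuantumFields.BalabanUV.Beta.GAN24.Push4Iter (legChain)
open Summit.QuantumFields.BalabanUV.Beta.GAN24.Push3 (push₃)
open Summit.QuantumFields.BalabanUV.Beta.GAN24.AffineUnroll (transport)
open Summit.QuantumFields.BalabanUV.Beta.GAN24.SrecLinearPartEq (colM rowMM reslot)
open Summit.QuantumFields.BalabanUV.Beta.GAN24.RespStepBmDecompExact (respStepBmSeq)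
open Summit.QuantumFields.BalabanUV.Beta.GAN24.CombBornSector (combFreshAt combUnitStepMap)
open Summit.QuantumFields.BalabanUV.Beta.GAN24.CombRelSourceHalfCharge (zsym_relSource_comb_half)
open Summit.QuantumFields.BalabanUV.Beta.GAN24.CombTowerEndAtPin (exists_allScalesSeq_JsB12CombShSym_an1_of_contactLetters_at_pin)
open Summit.QuantumFields.BalabanUV.Beta.GAN24.CombChargeConservationRow (zsymMember_comb_succ_eq_iff_rowC)
open Summit.QuantumFields.BalabanUV.Beta.GAN24.RowCChargeFormsLegSym (zsym_halfTable_legSym)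
open Summit.QuantumFields.BalabanUV.Beta.GAN24.CombRelSourceHalf (relSource_comb_half_eq)
open Summit.QuantumFields.BalabanUV.Beta.GAN24.CombRelSourceHalfCharge (locStencil₂_relSource_comb)
open Summit.QuantumFields.BalabanUV.Beta.GAN24.CombChargeConservationRow (zmodeSym_sourceB_comb_eq)
open Summit.QuantumFields.BalabanUV.Beta.GAN24.CombTowerEndAtPin (exists_allScalesSeq_JsB12CombShSym_an1_of_sRows_at_pin d1Drift_JsB12CombShSym_an1_iff_lim_eq_of_sRows_at_pin exists_allScalesSeq_JsB12CombShSym_an1_of_contactLetters_at_pin)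

open Summit.QuantumFields.BalabanUV.Beta.GAN24.CombChargeConservationRowLegSym (legBondSymSource_comb_eq_zero_iff zsym_relSource_comb_even_of_legBondSym)

namespace Summit.QuantumFields.BalabanUV.Beta.GAN24.CombChargeConservationRowLegSymContact

variable {Lc : ℕ} [NeZero Lc]

/-! ## §4 The same END with (b) read from road-P2 g56's six S-slot contact letters -/

/-- NOT IN PRINT; OUR BOOKKEEPING.  **THE G-an2-4 END AT ROW D1's LITERAL OF RECORD (III′) FROM road-P2 g56's SIX S-SLOT CONTACT LETTERS AND (d″) — NOTHING ELSE** (leaf-01 g83's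
`CombTowerEndAtPin.exists_allScalesSeq_JsB12CombShSym_an1_of_contactLetters_at_pin` with `hC` supplied from (d″) exactly as in §3; the OWNER g50's `CombChargeConservationRowContact` with (d′)
weakened to (d″)).  BOTH slots in campaign currency. -/
theorem exists_allScalesSeq_JsB12CombShSym_an1_of_contactLetters_legBondSymConserved (hLc : Odd Lc) (hLc2 : 2 ≤ Lc) {N : ℕ} (hN : 2 ≤ N) {cΛ cB : ℝ} (hΛ : cΛ * (Lc : ℝ) ^ 4 = 2) (hcB : cB = -((Lc : ℝ) ^ 12 / 4)) {p q : ℕ}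
    (hCT : ∃ κ' K : ℝ, 0 < κ' ∧ 0 ≤ K ∧
      ∀ (k : ℕ) (κ₁ : Fin (3 + 1)) (u' x' z' : Site (3 + 1)) (α β : Fin (3 + 1)),
        |push₃
            (legChain (fun j => legComp (fun α x κ u => psiKS (ctrOff (3 + 1) Lc) Lc u x (Sum.inl κ) (Sum.inl α)) (respStepBmSeq (d := 3) (ctr (3 + 1) Lc) Lc j)) 0 k)
            (legChain (fun j => legComp (fun α x κ u => psiKS (ctrOff (3 + 1) Lc) Lc u x (Sum.inl κ) (Sum.inl α)) (respStepBmSeq (d := 3) (ctr (3 + 1) Lc) Lc j)) 0 k)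
            (legChain (fun j => legComp (fun α x κ u => psiKS (ctrOff (3 + 1) Lc) Lc u x (Sum.inl κ) (Sum.inl α)) (respStepBmSeq (d := 3) (ctr (3 + 1) Lc) Lc j)) 0 k)
            (wilsonA 3) κ₁ u' x' z' (Sum.inl α) (Sum.inl β)
          - push₃ (respStep (d := 3) 1 (Lc ^ (k + 1))) (respStep (d := 3) 1 (Lc ^ (k + 1))) (respStep (d := 3) 1 (Lc ^ (k + 1)))
                (wilsonA 3) κ₁ u' x' z' (Sum.inl α) (Sum.inl β)|
          ≤ K * ((Lc : ℝ) ^ (12 * (k + 1)))⁻¹ * Real.exp (-(κ' * (supNorm (x' - u') + supNorm (z' - u')))))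
    (hCTd : ∃ K ϑ : ℝ, 0 ≤ K ∧ 0 ≤ ϑ ∧ ϑ < 1 ∧
      ∀ (k : ℕ) (κ₁ : Fin (3 + 1)) (u' x' z' : Site (3 + 1)) (α β : Fin (3 + 1)),
        |(Lc : ℝ) ^ (12 * (k + 2)) *
            (push₃
            (legChain (fun j => legComp (fun α x κ u => psiKS (ctrOff (3 + 1) Lc) Lc u x (Sum.inl κ) (Sum.inl α)) (respStepBmSeq (d := 3) (ctr (3 + 1) Lc) Lc j)) 0 (k + 1))
            (legChain (fun j => legComp (fun α x κ u => psiKS (ctrOff (3 + 1) Lc) Lc u x (Sum.inl κ) (Sum.inl α)) (respStepBmSeq (d := 3) (ctr (3 + 1) Lc) Lc j)) 0 (k + 1))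
            (legChain (fun j => legComp (fun α x κ u => psiKS (ctrOff (3 + 1) Lc) Lc u x (Sum.inl κ) (Sum.inl α)) (respStepBmSeq (d := 3) (ctr (3 + 1) Lc) Lc j)) 0 (k + 1))
            (wilsonA 3) κ₁ u' x' z' (Sum.inl α) (Sum.inl β)
              - push₃ (respStep (d := 3) 1 (Lc ^ (k + 2))) (respStep (d := 3) 1 (Lc ^ (k + 2))) (respStep (d := 3) 1 (Lc ^ (k + 2)))
                (wilsonA 3) κ₁ u' x' z' (Sum.inl α) (Sum.inl β))
          - (Lc : ℝ) ^ (12 * (k + 1)) *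
            (push₃
            (legChain (fun j => legComp (fun α x κ u => psiKS (ctrOff (3 + 1) Lc) Lc u x (Sum.inl κ) (Sum.inl α)) (respStepBmSeq (d := 3) (ctr (3 + 1) Lc) Lc j)) 0 k)
            (legChain (fun j => legComp (fun α x κ u => psiKS (ctrOff (3 + 1) Lc) Lc u x (Sum.inl κ) (Sum.inl α)) (respStepBmSeq (d := 3) (ctr (3 + 1) Lc) Lc j)) 0 k)
            (legChain (fun j => legComp (fun α x κ u => psiKS (ctrOff (3 + 1) Lc) Lc u x (Sum.inl κ) (Sum.inl α)) (respStepBmSeq (d := 3) (ctr (3 + 1) Lc) Lc j)) 0 k)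
            (wilsonA 3) κ₁ u' x' z' (Sum.inl α) (Sum.inl β)
              - push₃ (respStep (d := 3) 1 (Lc ^ (k + 1))) (respStep (d := 3) 1 (Lc ^ (k + 1))) (respStep (d := 3) 1 (Lc ^ (k + 1)))
                (wilsonA 3) κ₁ u' x' z' (Sum.inl α) (Sum.inl β))|
          ≤ K * ϑ ^ k)
    (hCg : ∃ C θ δ : ℝ, 0 ≤ C ∧ 0 ≤ θ ∧ θ < 1 ∧ 0 < δ ∧ ∀ k i : ℕ, i < k →
      LocStencil (fun κ' u' => ((Lc : ℝ) ^ 4 * (Lc : ℝ) ^ (2 * (3 + 1))) ^ (k - i) •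
        (push₃ (legChain (fun j => legComp (fun α x κ u => psiKS (ctrOff (3 + 1) Lc) Lc u x (Sum.inl κ) (Sum.inl α)) (respStepBmSeq (d := 3) (ctr (3 + 1) Lc) Lc j)) i (k - 1 - i)) (legChain (fun j => legComp (fun α x κ u => psiKS (ctrOff (3 + 1) Lc) Lc u x (Sum.inl κ) (Sum.inl α)) (respStepBmSeq (d := 3) (ctr (3 + 1) Lc) Lc j)) i (k - 1 - i))
              (legChain (fun j => legComp (fun α x κ u => psiKS (ctrOff (3 + 1) Lc) Lc u x (Sum.inl κ) (Sum.inl α)) (respStepBmSeq (d := 3) (ctr (3 + 1) Lc) Lc j)) i (k - 1 - i))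
              (unitS (sfStep Lc i) (smStep 3 Lc i) (combFreshAt (symTablesAn1S2 3 Lc cΛ) 0 cΛ i)) κ' u'
          - push₃ (respStep (d := 3) (Lc ^ i) (Lc ^ k)) (respStep (d := 3) (Lc ^ i) (Lc ^ k)) (respStep (d := 3) (Lc ^ i) (Lc ^ k))
              (unitS (sfStep Lc i) (smStep 3 Lc i) (combFreshAt (symTablesAn1S2 3 Lc cΛ) 0 cΛ i)) κ' u')) (C * ((((k - i : ℕ) : ℝ)) ^ p * θ ^ (k - i))) δ)
    (hPc : ∃ CPc Θc : ℝ, 0 ≤ CPc ∧ 0 ≤ Θc ∧ Θc < 1 ∧ ∀ k i : ℕ, 1 ≤ i → i < k → ∀ κ u,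
      SupBound
        (((fun κ' u' => ((Lc : ℝ) ^ 4 * (Lc : ℝ) ^ (2 * (3 + 1))) ^ (k - i) •
            (push₃ (legChain (fun j => legComp (fun α x κ u => psiKS (ctrOff (3 + 1) Lc) Lc u x (Sum.inl κ) (Sum.inl α)) (respStepBmSeq (d := 3) (ctr (3 + 1) Lc) Lc j)) (i + 1) (k - 1 - i)) (legChain (fun j => legComp (fun α x κ u => psiKS (ctrOff (3 + 1) Lc) Lc u x (Sum.inl κ) (Sum.inl α)) (respStepBmSeq (d := 3) (ctr (3 + 1) Lc) Lc j)) (i + 1) (k - 1 - i))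
              (legChain (fun j => legComp (fun α x κ u => psiKS (ctrOff (3 + 1) Lc) Lc u x (Sum.inl κ) (Sum.inl α)) (respStepBmSeq (d := 3) (ctr (3 + 1) Lc) Lc j)) (i + 1) (k - 1 - i))
              (unitS (sfStep Lc (i + 1)) (smStep 3 Lc (i + 1)) (combFreshAt (symTablesAn1S2 3 Lc cΛ) 0 cΛ (i + 1))) κ' u'
              - push₃ (respStep (d := 3) (Lc ^ (i + 1)) (Lc ^ (k + 1))) (respStep (d := 3) (Lc ^ (i + 1)) (Lc ^ (k + 1))) (respStep (d := 3) (Lc ^ (i + 1)) (Lc ^ (k + 1)))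
              (unitS (sfStep Lc (i + 1)) (smStep 3 Lc (i + 1)) (combFreshAt (symTablesAn1S2 3 Lc cΛ) 0 cΛ (i + 1))) κ' u'))
          - fun κ' u' => ((Lc : ℝ) ^ 4 * (Lc : ℝ) ^ (2 * (3 + 1))) ^ (k - i) •
            (push₃ (legChain (fun j => legComp (fun α x κ u => psiKS (ctrOff (3 + 1) Lc) Lc u x (Sum.inl κ) (Sum.inl α)) (respStepBmSeq (d := 3) (ctr (3 + 1) Lc) Lc j)) i (k - 1 - i)) (legChain (fun j => legComp (fun α x κ u => psiKS (ctrOff (3 + 1) Lc) Lc u x (Sum.inl κ) (Sum.inl α)) (respStepBmSeq (d := 3) (ctr (3 + 1) Lc) Lc j)) i (k - 1 - i))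
              (legChain (fun j => legComp (fun α x κ u => psiKS (ctrOff (3 + 1) Lc) Lc u x (Sum.inl κ) (Sum.inl α)) (respStepBmSeq (d := 3) (ctr (3 + 1) Lc) Lc j)) i (k - 1 - i))
              (unitS (sfStep Lc i) (smStep 3 Lc i) (combFreshAt (symTablesAn1S2 3 Lc cΛ) 0 cΛ i)) κ' u'
              - push₃ (respStep (d := 3) (Lc ^ i) (Lc ^ k)) (respStep (d := 3) (Lc ^ i) (Lc ^ k)) (respStep (d := 3) (Lc ^ i) (Lc ^ k))
              (unitS (sfStep Lc i) (smStep 3 Lc i) (combFreshAt (symTablesAn1S2 3 Lc cΛ) 0 cΛ i)) κ' u')) κ u)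
        (CPc * ((((k - i : ℕ) : ℝ)) ^ q * Θc ^ k)))
    (hCv : ∃ C θ δ : ℝ, 0 ≤ C ∧ 0 ≤ θ ∧ θ < 1 ∧ 0 < δ ∧ ∀ k i : ℕ, i < k →
      LocStencil (transport (combUnitStepMap Lc ((Lc : ℝ) ^ 4)) (i + 1) (k - 1 - i) (combUnitStepMap Lc ((Lc : ℝ) ^ 4) i (fun κ u => (-((Lc : ℝ) ^ 8 / 2)) • (symTablesAn1S2 3 Lc cΛ).V κ u))
        - (fun κ' u' => ((Lc : ℝ) ^ 4 * (Lc : ℝ) ^ (2 * (3 + 1))) ^ (k - i) •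
          push₃ (respStep (d := 3) (Lc ^ (i + 1)) (Lc ^ k)) (respStep (d := 3) (Lc ^ (i + 1)) (Lc ^ k)) (respStep (d := 3) (Lc ^ (i + 1)) (Lc ^ k))
            (fun κ u => -(push₃ (-respStep (d := 3) (Lc ^ i) (Lc ^ (i + 1))) (colM (KStepUnit (d := 3) Lc i) Lc)
                  (respStep (d := 3) (Lc ^ i) (Lc ^ (i + 1))) (reslot Sum.inl Sum.inr fun κ u => (-((Lc : ℝ) ^ 8 / 2)) • SymTables.V (symTablesAn1S2 3 Lc cΛ) κ u) κ u
              + push₃ (rowMM (KStepUnit (d := 3) Lc i) Lc) (respStep (d := 3) (Lc ^ i) (Lc ^ (i + 1)))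
                  (respStep (d := 3) (Lc ^ i) (Lc ^ (i + 1))) (reslot Sum.inr Sum.inl fun κ u => (-((Lc : ℝ) ^ 8 / 2)) • SymTables.V (symTablesAn1S2 3 Lc cΛ) κ u) κ u)) κ' u')) (C * ((((k - i : ℕ) : ℝ)) ^ p * θ ^ (k - i))) δ)
    (hPcV : ∃ CPc Θc : ℝ, 0 ≤ CPc ∧ 0 ≤ Θc ∧ Θc < 1 ∧ ∀ k i : ℕ, 1 ≤ i → i < k → ∀ κ u,
      SupBound
        (((transport (combUnitStepMap Lc ((Lc : ℝ) ^ 4)) (i + 1 + 1) (k - 1 - i) (combUnitStepMap Lc ((Lc : ℝ) ^ 4) (i + 1) (fun κ u => (-((Lc : ℝ) ^ 8 / 2)) • (symTablesAn1S2 3 Lc cΛ).V κ u))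
            - (fun κ' u' => ((Lc : ℝ) ^ 4 * (Lc : ℝ) ^ (2 * (3 + 1))) ^ (k - i) •
          push₃ (respStep (d := 3) (Lc ^ ((i + 1) + 1)) (Lc ^ (k + 1))) (respStep (d := 3) (Lc ^ ((i + 1) + 1)) (Lc ^ (k + 1))) (respStep (d := 3) (Lc ^ ((i + 1) + 1)) (Lc ^ (k + 1)))
            (fun κ u => -(push₃ (-respStep (d := 3) (Lc ^ (i + 1)) (Lc ^ ((i + 1) + 1))) (colM (KStepUnit (d := 3) Lc (i + 1)) Lc)
                  (respStep (d := 3) (Lc ^ (i + 1)) (Lc ^ ((i + 1) + 1))) (reslot Sum.inl Sum.inr fun κ u => (-((Lc : ℝ) ^ 8 / 2)) • SymTables.V (symTablesAn1S2 3 Lc cΛ) κ u) κ u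
              + push₃ (rowMM (KStepUnit (d := 3) Lc (i + 1)) Lc) (respStep (d := 3) (Lc ^ (i + 1)) (Lc ^ ((i + 1) + 1)))
                  (respStep (d := 3) (Lc ^ (i + 1)) (Lc ^ ((i + 1) + 1))) (reslot Sum.inr Sum.inl fun κ u => (-((Lc : ℝ) ^ 8 / 2)) • SymTables.V (symTablesAn1S2 3 Lc cΛ) κ u) κ u)) κ' u'))
          - (transport (combUnitStepMap Lc ((Lc : ℝ) ^ 4)) (i + 1) (k - 1 - i) (combUnitStepMap Lc ((Lc : ℝ) ^ 4) i (fun κ u => (-((Lc : ℝ) ^ 8 / 2)) • (symTablesAn1S2 3 Lc cΛ).V κ u))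
            - (fun κ' u' => ((Lc : ℝ) ^ 4 * (Lc : ℝ) ^ (2 * (3 + 1))) ^ (k - i) •
          push₃ (respStep (d := 3) (Lc ^ (i + 1)) (Lc ^ k)) (respStep (d := 3) (Lc ^ (i + 1)) (Lc ^ k)) (respStep (d := 3) (Lc ^ (i + 1)) (Lc ^ k))
            (fun κ u => -(push₃ (-respStep (d := 3) (Lc ^ i) (Lc ^ (i + 1))) (colM (KStepUnit (d := 3) Lc i) Lc)
                  (respStep (d := 3) (Lc ^ i) (Lc ^ (i + 1))) (reslot Sum.inl Sum.inr fun κ u => (-((Lc : ℝ) ^ 8 / 2)) • SymTables.V (symTablesAn1S2 3 Lc cΛ) κ u) κ u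
              + push₃ (rowMM (KStepUnit (d := 3) Lc i) Lc) (respStep (d := 3) (Lc ^ i) (Lc ^ (i + 1)))
                  (respStep (d := 3) (Lc ^ i) (Lc ^ (i + 1))) (reslot Sum.inr Sum.inl fun κ u => (-((Lc : ℝ) ^ 8 / 2)) • SymTables.V (symTablesAn1S2 3 Lc cΛ) κ u) κ u)) κ' u'))) κ u)
        (CPc * ((((k - i : ℕ) : ℝ)) ^ q * Θc ^ k)))
    -- (d″) THE COMB-CHART `T₂` TOWER CONSERVES ITS LEG-AND-BOND-SYMMETRISED ff ZERO-MODE CHARGE, level by level (in place of the (C)^{ev} row `hC`)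
    (hcons2 : ∀ (l : ℕ) (κ κ' κ₁ κ₂ : Fin (3 + 1)),
      (zmode Lc (unitS₂ (sfStep Lc (l + 1)) (smStep 3 Lc (l + 1)) (T2RecOf 3 Lc (GcombSh Lc) (SpureCombOf (symTablesAn1S2 3 Lc cΛ) ((Lc : ℝ) ^ 4) (-((Lc : ℝ) ^ 8 / 2)) cΛ) (symTablesAn1S2 3 Lc cΛ).M ((Lc : ℝ) ^ 8) cB ((8 * (N : ℝ) ^ 2)⁻¹ • wsym22 N) (symTablesAn1S2 3 Lc cΛ).vh₂S (symTablesAn1S2 3 Lc cΛ).mixFF (l + 1))) κ κ' (Sum.inl κ₁) (Sum.inl κ₂)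
          + zmode Lc (unitS₂ (sfStep Lc (l + 1)) (smStep 3 Lc (l + 1)) (T2RecOf 3 Lc (GcombSh Lc) (SpureCombOf (symTablesAn1S2 3 Lc cΛ) ((Lc : ℝ) ^ 4) (-((Lc : ℝ) ^ 8 / 2)) cΛ) (symTablesAn1S2 3 Lc cΛ).M ((Lc : ℝ) ^ 8) cB ((8 * (N : ℝ) ^ 2)⁻¹ • wsym22 N) (symTablesAn1S2 3 Lc cΛ).vh₂S (symTablesAn1S2 3 Lc cΛ).mixFF (l + 1))) κ' κ (Sum.inl κ₁) (Sum.inl κ₂))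
        + (zmode Lc (unitS₂ (sfStep Lc (l + 1)) (smStep 3 Lc (l + 1)) (T2RecOf 3 Lc (GcombSh Lc) (SpureCombOf (symTablesAn1S2 3 Lc cΛ) ((Lc : ℝ) ^ 4) (-((Lc : ℝ) ^ 8 / 2)) cΛ) (symTablesAn1S2 3 Lc cΛ).M ((Lc : ℝ) ^ 8) cB ((8 * (N : ℝ) ^ 2)⁻¹ • wsym22 N) (symTablesAn1S2 3 Lc cΛ).vh₂S (symTablesAn1S2 3 Lc cΛ).mixFF (l + 1))) κ κ' (Sum.inl κ₂) (Sum.inl κ₁)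
          + zmode Lc (unitS₂ (sfStep Lc (l + 1)) (smStep 3 Lc (l + 1)) (T2RecOf 3 Lc (GcombSh Lc) (SpureCombOf (symTablesAn1S2 3 Lc cΛ) ((Lc : ℝ) ^ 4) (-((Lc : ℝ) ^ 8 / 2)) cΛ) (symTablesAn1S2 3 Lc cΛ).M ((Lc : ℝ) ^ 8) cB ((8 * (N : ℝ) ^ 2)⁻¹ • wsym22 N) (symTablesAn1S2 3 Lc cΛ).vh₂S (symTablesAn1S2 3 Lc cΛ).mixFF (l + 1))) κ' κ (Sum.inl κ₂) (Sum.inl κ₁))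
      = (zmode Lc (unitS₂ (sfStep Lc l) (smStep 3 Lc l) (T2RecOf 3 Lc (GcombSh Lc) (SpureCombOf (symTablesAn1S2 3 Lc cΛ) ((Lc : ℝ) ^ 4) (-((Lc : ℝ) ^ 8 / 2)) cΛ) (symTablesAn1S2 3 Lc cΛ).M ((Lc : ℝ) ^ 8) cB ((8 * (N : ℝ) ^ 2)⁻¹ • wsym22 N) (symTablesAn1S2 3 Lc cΛ).vh₂S (symTablesAn1S2 3 Lc cΛ).mixFF l)) κ κ' (Sum.inl κ₁) (Sum.inl κ₂)
            + zmode Lc (unitS₂ (sfStep Lc l) (smStep 3 Lc l) (T2RecOf 3 Lc (GcombSh Lc) (SpureCombOf (symTablesAn1S2 3 Lc cΛ) ((Lc : ℝ) ^ 4) (-((Lc : ℝ) ^ 8 / 2)) cΛ) (symTablesAn1S2 3 Lc cΛ).M ((Lc : ℝ) ^ 8) cB ((8 * (N : ℝ) ^ 2)⁻¹ • wsym22 N) (symTablesAn1S2 3 Lc cΛ).vh₂S (symTablesAn1S2 3 Lc cΛ).mixFF l)) κ' κ (Sum.inl κ₁) (Sum.inl κ₂))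
          + (zmode Lc (unitS₂ (sfStep Lc l) (smStep 3 Lc l) (T2RecOf 3 Lc (GcombSh Lc) (SpureCombOf (symTablesAn1S2 3 Lc cΛ) ((Lc : ℝ) ^ 4) (-((Lc : ℝ) ^ 8 / 2)) cΛ) (symTablesAn1S2 3 Lc cΛ).M ((Lc : ℝ) ^ 8) cB ((8 * (N : ℝ) ^ 2)⁻¹ • wsym22 N) (symTablesAn1S2 3 Lc cΛ).vh₂S (symTablesAn1S2 3 Lc cΛ).mixFF l)) κ κ' (Sum.inl κ₂) (Sum.inl κ₁)
            + zmode Lc (unitS₂ (sfStep Lc l) (smStep 3 Lc l) (T2RecOf 3 Lc (GcombSh Lc) (SpureCombOf (symTablesAn1S2 3 Lc cΛ) ((Lc : ℝ) ^ 4) (-((Lc : ℝ) ^ 8 / 2)) cΛ) (symTablesAn1S2 3 Lc cΛ).M ((Lc : ℝ) ^ 8) cB ((8 * (N : ℝ) ^ 2)⁻¹ • wsym22 N) (symTablesAn1S2 3 Lc cΛ).vh₂S (symTablesAn1S2 3 Lc cΛ).mixFF l)) κ' κ (Sum.inl κ₂) (Sum.inl κ₁)))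
    (μ ν : Fin 4) :
    ∃ κ θ : ℝ, 0 ≤ θ ∧ θ < 1 ∧ AllScalesSeq (fun j => B12Beta.secondMoment (TbalOf Lc (JsB12CombShSym hLc N (symTablesAn1S2 3 Lc cΛ) cΛ cB) j) μ ν) κ θ := by
  refine exists_allScalesSeq_JsB12CombShSym_an1_of_contactLetters_at_pin hLc hLc2 hN hΛ hcB hCT hCTd hCg hPc hCv hPcV ?_ μ ν
  have hpin : ((Lc : ℝ) ^ 8) = (Lc : ℝ) ^ (3 + 5) := by norm_num
  have hrow := fun (l : ℕ) (κ κ' κ₁ κ₂ : Fin (3 + 1)) =>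
    (legBondSymSource_comb_eq_zero_iff (d := 3) (symTablesAn1S2 3 Lc cΛ) ((Lc : ℝ) ^ 4) (-((Lc : ℝ) ^ 8 / 2)) cΛ ((Lc : ℝ) ^ 8) cB
      ((8 * (N : ℝ) ^ 2)⁻¹ • wsym22 N) hpin l κ κ' κ₁ κ₂).2 (hcons2 l κ κ' κ₁ κ₂)
  intro l κ κ' κ₁ κ₂
  simpa only [one_smul] using
    zsym_relSource_comb_even_of_legBondSym (d := 3) (symTablesAn1S2 3 Lc cΛ) ((Lc : ℝ) ^ 4) (-((Lc : ℝ) ^ 8 / 2)) cΛ ((Lc : ℝ) ^ 8) cB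
      ((8 * (N : ℝ) ^ 2)⁻¹ • wsym22 N) (fun _ _ _ _ _ _ _ _ => rfl) (fun _ _ _ _ _ _ _ _ => rfl) hrow l κ κ' κ₁ κ₂

end Summit.QuantumFields.BalabanUV.Beta.GAN24.CombChargeConservationRowLegSymContact

end
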